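import Summits.Ventures.LatticeQCDFlow.Scoring.U1TorusPartitionFunctionBessel
import Mathlib.Analysis.Fourier.FourierTransformDeriv
import HarnessLib

/-!
# Derivatives of the Fourier transform of the sector-weight function of 2-d `U(1)` and their values at the integers

HONEST FRAMING: exact (Metropolis-corrected) sampling algorithms for lattice gauge theory;
figures of merit are autocorrelation/cost numbers at stated couplings and volumes; no
continuum-physics claim.

Venture `LatticeQCDFlow` (cell pub-lqcd), sub-topic `Scoring`; FANOUT row 5 (`s0-sun-a`), GEN-14.
NEW WORK of the cell (placement rule).  `Scoring/U1TorusTopologicalChargeLaw.lean` (GEN-8) gives the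
law of theory-2's topological charge on `(ℤ/L)²`, `P(Q = k) = g_V(2πk)/Σ_j g_V(2πj)` with
`g_V = p_β^{*V}`, `p_β = e^{−β(1−cos φ)} 1_{[−π,π]}`, `V = L²`, and
`Scoring/U1TorusPartitionFunctionBessel.lean` sums the DENOMINATOR by Poisson summation using
`𝓕(g_V(2π·))(ξ) = (2π)⁻¹ f(ξ)^V`, `f(ξ) = 𝓕 p_β (ξ/2π)`, `f(n) = 2π e^{−β} I_{|n|}(β)`.  The NUMERATOR
of `⟨Q²⟩ = Σ_k k² P(Q = k)` needs the Fourier transform of `x ↦ (−2πix)² g_V(2πx)`, i.e. the SECOND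
DERIVATIVE of `ξ ↦ (2π)⁻¹ f(ξ)^V` (Mathlib's `Real.iteratedDeriv_fourier`).  This file computes it:

* §1 weighted transforms `𝓕(h·p_β)` as period integrals, integrability of the moment weights
  `p₁ = (−2πix) p_β`, `p₂ = (−2πix)² p_β`;
* §2 `f′ = (2π)⁻¹ 𝓕p₁(·/2π)`, `(𝓕p₁(·/2π))′ = (2π)⁻¹ 𝓕p₂(·/2π)` (`Real.hasDerivAt_fourier`) and
  **`iteratedDeriv_two_fourier_cconvPow`**: `(𝓕 g_V(2π·))″ = (2π)⁻¹ V [(V−1) f^{V−2} f′² + f^{V−1} f″]`;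
* §3 the values at the integers — the "incomplete Bessel integrals"
  `𝓕p₁(n/2π) = −2π S_n`, `𝓕p₂(n/2π) = −4π² C_n`,
  `S_n = ∫_{−π}^{π} v sin(nv) e^{−β(1−cos v)} dv`, `C_n = ∫_{−π}^{π} v² cos(nv) e^{−β(1−cos v)} dv`
  (the odd parts `∫ v cos(nv) e^{…}`, `∫ v² sin(nv) e^{…}` vanish), whence
  **`iteratedDeriv_two_fourier_cconvPow_intCast`**:
  `(𝓕 g_V(2π·))″(n) = (2π)⁻¹ V [(V−1) f_n^{V−2} S_n² − f_n^{V−1} C_n]`, `V ≥ 3`.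

The companion `Scoring/U1TorusTopologicalChargePoisson.lean` performs the Poisson summation
`Σ_k k² g_V(2πk) = (V/(8π³)) Σ_n [f_n^{V−1} C_n − (V−1) f_n^{V−2} S_n²]`.
Elementary on top of Mathlib; nothing is cited.
-/

noncomputable section

open MeasureTheory Set Real Filter Topology Complex Asymptotics
open scoped ENNReal Convolution FourierTransform
open Literature.Analysis.FunctionSpaces

namespace Summit.Ventures.LatticeQCDFlow.Scoring

variable (β : ℝ)

/-! ### 1. Weighted Fourier transforms of the one-plaquette weight -/

/-- `𝓕 (h · p_β) ξ = ∫_{−π}^{π} e^{−2πi v ξ} h(v) e^{−β(1−cos v)} dv` for every `h`. -/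
theorem fourier_mul_u1AngleWeightC_eq (h : ℝ → ℂ) (ξ : ℝ) :
    𝓕 (fun x => h x * u1AngleWeightC β x) ξ =
      ∫ v in (-π)..π, cexp (↑(-2 * π * v * ξ) * I) * (h v * (u1PlaqDensity β v : ℂ)) := by
  rw [Real.fourier_real_eq_integral_exp_smul]
  have hfun : (fun v : ℝ => cexp (↑(-2 * π * v * ξ) * I) • (h v * u1AngleWeightC β v)) =
      (Icc (-π) π).indicator
        (fun v : ℝ => cexp (↑(-2 * π * v * ξ) * I) * (h v * (u1PlaqDensity β v : ℂ))) := by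
    funext v
    rw [u1AngleWeightC_eq_indicator, smul_eq_mul]
    by_cases hv : v ∈ Icc (-π) π
    · rw [indicator_of_mem hv, indicator_of_mem hv]
    · rw [indicator_of_notMem hv, indicator_of_notMem hv, mul_zero, mul_zero]
  rw [hfun, integral_indicator measurableSet_Icc, integral_Icc_eq_integral_Ioc,
    intervalIntegral.integral_of_le (by linarith [Real.pi_pos])]

/-- `h · p_β` is integrable for continuous `h` (a continuous function on the compact period). -/
theorem integrable_mul_u1AngleWeightC {h : ℝ → ℂ} (hh : Continuous h) :
    Integrable fun x => h x * u1AngleWeightC β x := by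
  have hfun : (fun x : ℝ => h x * u1AngleWeightC β x) =
      (Icc (-π) π).indicator (fun v : ℝ => h v * (u1PlaqDensity β v : ℂ)) := by
    funext v
    rw [u1AngleWeightC_eq_indicator]
    by_cases hv : v ∈ Icc (-π) π
    · rw [indicator_of_mem hv, indicator_of_mem hv]
    · rw [indicator_of_notMem hv, indicator_of_notMem hv, mul_zero]
  rw [hfun]
  refine IntegrableOn.integrable_indicator ?_ measurableSet_Icc
  exact (hh.mul (Complex.continuous_ofReal.comp (continuous_u1PlaqDensity β))).continuousOn
    |>.integrableOn_compact isCompact_Icc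

/-- `x • p_β(x)` is integrable (hypothesis of `Real.hasDerivAt_fourier`). -/
theorem integrable_smul_u1AngleWeightC : Integrable fun x : ℝ => x • u1AngleWeightC β x := by
  have h := integrable_mul_u1AngleWeightC β (h := fun x : ℝ => (x : ℂ)) Complex.continuous_ofReal
  refine h.congr (Eventually.of_forall fun x => ?_)
  simp only [Complex.real_smul]

/-- The first-moment weight `p₁(x) = (−2πix) p_β(x)` is integrable. -/
theorem integrable_moment_u1AngleWeightC :
    Integrable fun x : ℝ => (-2 * π * I * x) • u1AngleWeightC β x := by
  have h := integrable_mul_u1AngleWeightC β (h := fun x : ℝ => -2 * π * I * x) (by fun_prop)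
  refine h.congr (Eventually.of_forall fun x => ?_)
  simp only [smul_eq_mul]

/-- `x • p₁(x)` is integrable. -/
theorem integrable_smul_moment_u1AngleWeightC :
    Integrable fun x : ℝ => x • ((-2 * π * I * x) • u1AngleWeightC β x) := by
  have h := integrable_mul_u1AngleWeightC β (h := fun x : ℝ => (x : ℂ) * (-2 * π * I * x))
    (by fun_prop)
  refine h.congr (Eventually.of_forall fun x => ?_)
  simp only [smul_eq_mul, Complex.real_smul, mul_assoc]

/-- The second-moment weight `p₂(x) = (−2πix)² p_β(x)` is integrable. -/
theorem integrable_moment_two_u1AngleWeightC :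
    Integrable fun x : ℝ => (-2 * π * I * x) • ((-2 * π * I * x) • u1AngleWeightC β x) := by
  have h := integrable_mul_u1AngleWeightC β (h := fun x : ℝ => (-2 * π * I * x) * (-2 * π * I * x))
    (by fun_prop)
  refine h.congr (Eventually.of_forall fun x => ?_)
  simp only [smul_eq_mul, mul_assoc]

/-! ### 2. The derivatives of `f(ξ) = 𝓕 p_β (ξ/2π)` -/

/-- `f′(ξ) = (2π)⁻¹ 𝓕 p₁ (ξ/2π)`. -/
theorem hasDerivAt_fourier_u1AngleWeightC_div (ξ : ℝ) :
    HasDerivAt (fun ξ : ℝ => 𝓕 (u1AngleWeightC β) (ξ / (2 * π)))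
      ((((2 * π)⁻¹ : ℝ) : ℂ) *
        𝓕 (fun x : ℝ => (-2 * π * I * x) • u1AngleWeightC β x) (ξ / (2 * π))) ξ := by
  have h1 := Real.hasDerivAt_fourier (integrable_u1AngleWeightC β) (integrable_smul_u1AngleWeightC β)
    (ξ / (2 * π))
  have h2 : HasDerivAt (fun ξ : ℝ => ξ / (2 * π)) (2 * π)⁻¹ ξ := by
    simpa [div_eq_mul_inv] using (hasDerivAt_id ξ).mul_const (2 * π)⁻¹
  have h := h1.scomp ξ h2
  rw [Complex.real_smul] at h
  exact h

/-- `(𝓕 p₁ (·/2π))′(ξ) = (2π)⁻¹ 𝓕 p₂ (ξ/2π)`. -/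
theorem hasDerivAt_fourier_moment_div (ξ : ℝ) :
    HasDerivAt (fun ξ : ℝ => 𝓕 (fun x : ℝ => (-2 * π * I * x) • u1AngleWeightC β x) (ξ / (2 * π)))
      ((((2 * π)⁻¹ : ℝ) : ℂ) *
        𝓕 (fun x : ℝ => (-2 * π * I * x) • ((-2 * π * I * x) • u1AngleWeightC β x))
          (ξ / (2 * π))) ξ := by
  have h1 := Real.hasDerivAt_fourier (integrable_moment_u1AngleWeightC β)
    (integrable_smul_moment_u1AngleWeightC β) (ξ / (2 * π))
  have h2 : HasDerivAt (fun ξ : ℝ => ξ / (2 * π)) (2 * π)⁻¹ ξ := by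
    simpa [div_eq_mul_inv] using (hasDerivAt_id ξ).mul_const (2 * π)⁻¹
  have h := h1.scomp ξ h2
  rw [Complex.real_smul] at h
  exact h

/-- **The second derivative of `ξ ↦ 𝓕(g_V(2π·))(ξ) = (2π)⁻¹ f(ξ)^V`** (`V = m + 3`):
`(2π)⁻¹ V [(V−1) f^{V−2} f′² + f^{V−1} f″]` with `f′ = (2π)⁻¹ 𝓕p₁(·/2π)`, `f″ = (2π)⁻² 𝓕p₂(·/2π)`. -/
theorem iteratedDeriv_two_fourier_cconvPow (m : ℕ) (ξ : ℝ) :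
    iteratedDeriv 2 (𝓕 (fun x : ℝ => cconvPow β (m + 2) (2 * π * x))) ξ =
      (((2 * π)⁻¹ : ℝ) : ℂ) * ((m + 3 : ℕ) *
        ((m + 2 : ℕ) * (𝓕 (u1AngleWeightC β) (ξ / (2 * π))) ^ (m + 1) *
          ((((2 * π)⁻¹ : ℝ) : ℂ) *
            𝓕 (fun x : ℝ => (-2 * π * I * x) • u1AngleWeightC β x) (ξ / (2 * π))) ^ 2 +
        (𝓕 (u1AngleWeightC β) (ξ / (2 * π))) ^ (m + 2) *
          ((((2 * π)⁻¹ : ℝ) : ℂ) * ((((2 * π)⁻¹ : ℝ) : ℂ) *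
            𝓕 (fun x : ℝ => (-2 * π * I * x) • ((-2 * π * I * x) • u1AngleWeightC β x))
              (ξ / (2 * π)))))) := by
  -- abbreviations
  set c : ℂ := (((2 * π)⁻¹ : ℝ) : ℂ) with hc
  set φ : ℝ → ℂ := fun ξ => 𝓕 (u1AngleWeightC β) (ξ / (2 * π)) with hφ
  set φ₁ : ℝ → ℂ := fun ξ =>
    c * 𝓕 (fun x : ℝ => (-2 * π * I * x) • u1AngleWeightC β x) (ξ / (2 * π)) with hφ₁
  set φ₂ : ℝ → ℂ := fun ξ => c * (c *
    𝓕 (fun x : ℝ => (-2 * π * I * x) • ((-2 * π * I * x) • u1AngleWeightC β x)) (ξ / (2 * π)))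
    with hφ₂
  have hdφ : ∀ ξ, HasDerivAt φ (φ₁ ξ) ξ := fun ξ => hasDerivAt_fourier_u1AngleWeightC_div β ξ
  have hdφ₁ : ∀ ξ, HasDerivAt φ₁ (φ₂ ξ) ξ := fun ξ =>
    (hasDerivAt_fourier_moment_div β ξ).const_mul c
  -- the Fourier transform as a function of `φ`
  have hF : 𝓕 (fun x : ℝ => cconvPow β (m + 2) (2 * π * x)) = fun ξ => c * φ ξ ^ (m + 3) := by
    funext ξ
    rw [show m + 2 = (m + 1) + 1 from rfl, fourier_cconvPow_two_pi_mul]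
  -- first derivative
  have hD1 : ∀ ξ, HasDerivAt (fun ξ => c * φ ξ ^ (m + 3))
      (c * (((m + 3 : ℕ) : ℂ) * φ ξ ^ (m + 2) * φ₁ ξ)) ξ := fun ξ => by
    have h := ((hdφ ξ).fun_pow (m + 3)).const_mul c
    simpa using h
  have hderiv1 : deriv (fun ξ => c * φ ξ ^ (m + 3)) =
      fun ξ => c * (((m + 3 : ℕ) : ℂ) * φ ξ ^ (m + 2) * φ₁ ξ) :=
    funext fun ξ => (hD1 ξ).deriv
  -- second derivative
  have hD2 : ∀ ξ, HasDerivAt (fun ξ => c * (((m + 3 : ℕ) : ℂ) * φ ξ ^ (m + 2) * φ₁ ξ))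
      (c * (((m + 3 : ℕ) : ℂ) * ((((m + 2 : ℕ) : ℂ) * φ ξ ^ (m + 1) * φ₁ ξ) * φ₁ ξ +
        φ ξ ^ (m + 2) * φ₂ ξ))) ξ := fun ξ => by
    have hp : HasDerivAt (fun ξ => φ ξ ^ (m + 2)) (((m + 2 : ℕ) : ℂ) * φ ξ ^ (m + 1) * φ₁ ξ) ξ := by
      have h := (hdφ ξ).fun_pow (m + 2)
      simpa using h
    have h := ((hp.mul (hdφ₁ ξ)).const_mul (((m + 3 : ℕ) : ℂ))).const_mul c
    have hfun : (fun ξ => c * (((m + 3 : ℕ) : ℂ) * φ ξ ^ (m + 2) * φ₁ ξ)) =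
        fun ξ => c * (((m + 3 : ℕ) : ℂ) * (φ ξ ^ (m + 2) * φ₁ ξ)) := by
      funext ξ; ring
    rw [hfun]
    exact h
  rw [iteratedDeriv_succ, iteratedDeriv_one, hF, hderiv1, (hD2 ξ).deriv]
  simp only [hφ, hφ₁, hφ₂, hc]
  ring

/-! ### 3. The values at the integers -/

/-- The integral of an odd function over the symmetric period vanishes. -/
theorem intervalIntegral_neg_pi_pi_eq_zero_of_odd {g : ℝ → ℂ} (hg : ∀ v, g (-v) = -g v) :
    ∫ v in (-π)..π, g v = 0 := by
  have h := intervalIntegral.integral_comp_neg (a := -π) (b := π) (f := g)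
  rw [neg_neg] at h
  have h2 : ∫ v in (-π)..π, g (-v) = -∫ v in (-π)..π, g v := by
    rw [← intervalIntegral.integral_neg]
    exact intervalIntegral.integral_congr fun v _ => hg v
  have h3 : ∫ v in (-π)..π, g v = -∫ v in (-π)..π, g v := h.symm.trans h2
  have h4 : (2 : ℂ) * ∫ v in (-π)..π, g v = 0 := by rw [two_mul]; nth_rw 2 [h3]; ring
  simpa using h4

/-- **`𝓕 p₁ (n/2π) = −2π S_n`**, `S_n = ∫_{−π}^{π} v sin(nv) e^{−β(1−cos v)} dv` (the even part
`∫ v cos(nv) e^{…}` of `∫ v e^{−inv} e^{…}` vanishes by oddness). -/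
theorem fourier_moment_intCast_div (n : ℤ) :
    𝓕 (fun x : ℝ => (-2 * π * I * x) • u1AngleWeightC β x) ((n : ℝ) / (2 * π)) =
      ((-(2 * π) * ∫ v in (-π)..π, v * Real.sin (n * v) * u1PlaqDensity β v : ℝ) : ℂ) := by
  have hπ : (π : ℝ) ≠ 0 := Real.pi_pos.ne'
  simp_rw [smul_eq_mul]
  rw [fourier_mul_u1AngleWeightC_eq]
  -- split the phase into cosine and sine
  have hint : ∀ v : ℝ, cexp (↑(-2 * π * v * ((n : ℝ) / (2 * π))) * I) *
      (-2 * π * I * v * (u1PlaqDensity β v : ℂ)) =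
      (((2 * π) * (v * Real.cos (n * v) * u1PlaqDensity β v) : ℝ) : ℂ) * (-I) +
        (((-(2 * π)) * (v * Real.sin (n * v) * u1PlaqDensity β v) : ℝ) : ℂ) := by
    intro v
    have h1 : (-2 * π * v * ((n : ℝ) / (2 * π)) : ℝ) = -(n * v) := by field_simp
    rw [h1, Complex.exp_mul_I, ← Complex.ofReal_cos, ← Complex.ofReal_sin, Real.cos_neg,
      Real.sin_neg]
    push_cast
    linear_combination (2 * (π : ℂ) * (v : ℂ) * Complex.sin ((n : ℂ) * (v : ℂ)) *
      (u1PlaqDensity β v : ℂ)) * Complex.I_mul_I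
  simp_rw [hint]
  have hc1 : Continuous fun v : ℝ =>
      (((2 * π) * (v * Real.cos (n * v) * u1PlaqDensity β v) : ℝ) : ℂ) * (-I) :=
    (Complex.continuous_ofReal.comp (by
      exact (continuous_const.mul ((continuous_id.mul (Real.continuous_cos.comp
        (continuous_const.mul continuous_id))).mul (continuous_u1PlaqDensity β))))).mul
      continuous_const
  have hc2 : Continuous fun v : ℝ =>
      (((-(2 * π)) * (v * Real.sin (n * v) * u1PlaqDensity β v) : ℝ) : ℂ) :=
    Complex.continuous_ofReal.comp (by
      exact (continuous_const.mul ((continuous_id.mul (Real.continuous_sin.comp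
        (continuous_const.mul continuous_id))).mul (continuous_u1PlaqDensity β))))
  rw [intervalIntegral.integral_add (hc1.intervalIntegrable _ _) (hc2.intervalIntegrable _ _)]
  -- the cosine part is odd
  have hodd : ∫ v in (-π)..π,
      (((2 * π) * (v * Real.cos (n * v) * u1PlaqDensity β v) : ℝ) : ℂ) * (-I) = 0 := by
    refine intervalIntegral_neg_pi_pi_eq_zero_of_odd fun v => ?_
    simp only [u1PlaqDensity, mul_neg, Real.cos_neg, neg_mul]
    push_cast
    ring
  rw [hodd, zero_add, intervalIntegral.integral_ofReal, intervalIntegral.integral_const_mul]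

/-- **`𝓕 p₂ (n/2π) = −4π² C_n`**, `C_n = ∫_{−π}^{π} v² cos(nv) e^{−β(1−cos v)} dv` (the odd part
`∫ v² sin(nv) e^{…}` vanishes). -/
theorem fourier_moment_two_intCast_div (n : ℤ) :
    𝓕 (fun x : ℝ => (-2 * π * I * x) • ((-2 * π * I * x) • u1AngleWeightC β x))
        ((n : ℝ) / (2 * π)) =
      ((-(4 * π ^ 2) * ∫ v in (-π)..π, v ^ 2 * Real.cos (n * v) * u1PlaqDensity β v : ℝ) : ℂ) := by
  have hπ : (π : ℝ) ≠ 0 := Real.pi_pos.ne'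
  have hfun : (fun x : ℝ => (-2 * π * I * x) • ((-2 * π * I * x) • u1AngleWeightC β x)) =
      fun x : ℝ => (-2 * π * I * x) * (-2 * π * I * x) * u1AngleWeightC β x := by
    funext x; simp only [smul_eq_mul, mul_assoc]
  rw [hfun, fourier_mul_u1AngleWeightC_eq]
  have hint : ∀ v : ℝ, cexp (↑(-2 * π * v * ((n : ℝ) / (2 * π))) * I) *
      ((-2 * π * I * v) * (-2 * π * I * v) * (u1PlaqDensity β v : ℂ)) =
      (((-(4 * π ^ 2)) * (v ^ 2 * Real.cos (n * v) * u1PlaqDensity β v) : ℝ) : ℂ) +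
        (((4 * π ^ 2) * (v ^ 2 * Real.sin (n * v) * u1PlaqDensity β v) : ℝ) : ℂ) * I := by
    intro v
    have h1 : (-2 * π * v * ((n : ℝ) / (2 * π)) : ℝ) = -(n * v) := by field_simp
    rw [h1, Complex.exp_mul_I, ← Complex.ofReal_cos, ← Complex.ofReal_sin, Real.cos_neg,
      Real.sin_neg]
    push_cast
    linear_combination (4 * (π : ℂ) ^ 2 * (v : ℂ) ^ 2 * (u1PlaqDensity β v : ℂ) *
      (Complex.cos ((n : ℂ) * (v : ℂ)) - Complex.sin ((n : ℂ) * (v : ℂ)) * I)) * Complex.I_mul_I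
  simp_rw [hint]
  have hc1 : Continuous fun v : ℝ =>
      (((-(4 * π ^ 2)) * (v ^ 2 * Real.cos (n * v) * u1PlaqDensity β v) : ℝ) : ℂ) :=
    Complex.continuous_ofReal.comp (by
      exact (continuous_const.mul (((continuous_id.pow 2).mul (Real.continuous_cos.comp
        (continuous_const.mul continuous_id))).mul (continuous_u1PlaqDensity β))))
  have hc2 : Continuous fun v : ℝ =>
      (((4 * π ^ 2) * (v ^ 2 * Real.sin (n * v) * u1PlaqDensity β v) : ℝ) : ℂ) * I :=
    (Complex.continuous_ofReal.comp (by
      exact (continuous_const.mul (((continuous_id.pow 2).mul (Real.continuous_sin.comp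
        (continuous_const.mul continuous_id))).mul (continuous_u1PlaqDensity β))))).mul
      continuous_const
  rw [intervalIntegral.integral_add (hc1.intervalIntegrable _ _) (hc2.intervalIntegrable _ _)]
  have hodd : ∫ v in (-π)..π,
      (((4 * π ^ 2) * (v ^ 2 * Real.sin (n * v) * u1PlaqDensity β v) : ℝ) : ℂ) * I = 0 := by
    refine intervalIntegral_neg_pi_pi_eq_zero_of_odd fun v => ?_
    simp only [u1PlaqDensity, mul_neg, Real.cos_neg, Real.sin_neg, neg_mul, neg_sq]
    push_cast
    ring
  rw [hodd, add_zero, intervalIntegral.integral_ofReal, intervalIntegral.integral_const_mul]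

/-- **The second derivative at the integers**, in terms of `I_{|n|}(β)`, `S_n`, `C_n`:
`(𝓕 g_V(2π·))″(n) = (2π)⁻¹ V [(V−1) f_n^{V−2} S_n² − f_n^{V−1} C_n]`, `f_n = 2π e^{−β} I_{|n|}(β)`,
`V = m + 3`. -/
theorem iteratedDeriv_two_fourier_cconvPow_intCast (m : ℕ) (n : ℤ) :
    iteratedDeriv 2 (𝓕 (fun x : ℝ => cconvPow β (m + 2) (2 * π * x))) (n : ℝ) =
      (((2 * π)⁻¹ * ((m + 3 : ℕ) *
        ((m + 2 : ℕ) * (2 * π * Real.exp (-β) * besselI n.natAbs β) ^ (m + 1) *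
            (∫ v in (-π)..π, v * Real.sin (n * v) * u1PlaqDensity β v) ^ 2 -
          (2 * π * Real.exp (-β) * besselI n.natAbs β) ^ (m + 2) *
            ∫ v in (-π)..π, v ^ 2 * Real.cos (n * v) * u1PlaqDensity β v)) : ℝ) : ℂ) := by
  have hπ : (π : ℝ) ≠ 0 := Real.pi_pos.ne'
  rw [iteratedDeriv_two_fourier_cconvPow, fourier_u1AngleWeightC_int_div,
    fourier_moment_intCast_div, fourier_moment_two_intCast_div]
  generalize (∫ v in (-π)..π, v * Real.sin (n * v) * u1PlaqDensity β v) = S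
  generalize (∫ v in (-π)..π, v ^ 2 * Real.cos (n * v) * u1PlaqDensity β v) = C
  push_cast
  field_simp
  ring

end Summit.Ventures.LatticeQCDFlow.Scoring
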